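import Summits.Ventures.YMGap.Thresholds.StarLemmaGSuperSolution
import Summits.Ventures.YMGap.Thresholds.StarGaugeInvariance
import Literature.Probability.LatticeModels.DobrushinComparisonBoundary
import HarnessLib

/-!
# Venture YMGap — track (c) «DS»: the star window contraction for `SU(N)`, `d = 4`, from ANY
# single-link Dobrushin coefficient `c · n(x, z)` (generic-`N` form of the cell's Lemma G)

HONEST FRAMING: venture file (cell `pub-ymgap`), strong-coupling LATTICE bookkeeping for `SU(N)` lattice
Yang–Mills on the torus `(ℤ/L)^4` with the Wilson plaquette weight `exp(−β (N − Re tr U_q))` (tree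
coupling `β`, 't Hooft `β/N`); nothing about the continuum, confinement at weak coupling, or the mass gap.
This is the GENERIC-`N` form of ds-4's capstone `StarLemmaG.starWindowBound_lemmaG` (`SU(2)`, sharp
quarter modulus, `c = β_W/4`): the whole gauge-fixed star argument — Haar averaging of the observable at
the centre, freezing one star link, Föllmer's two-boundary comparison on the frozen star with the explicit
super-solution `dvec`, averaging over the two star links of the kicked plaquette — uses the group only
through (i) the class-function property of the plaquette weight, (ii) the bi-invariance of the Frobenius
link distance, and (iii) the single-link Dobrushin coefficients `C(x, z) = c · tInfluence x z` of the torus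
Wilson specification (`IsKRContraction`).  Here (iii) is taken as the HYPOTHESIS, with `0 ≤ c < 1/6`; the
tree's `isKRContraction_torusWilson` supplies it from any one-link modulus `OneLinkKRModulus N R K`
(`c = K·|β|/N`, tilt radius `R ≥ 6|β|/N`): the Bakry–Émery modulus `oneLinkKRModulus_SU`
(`K = 1/(1/2 − R)`, every `N ≥ 2`, hypothesis-free), the `SU(2)` quarter modulus (`K = 1`), or a
variance modulus (`oneLinkKRModulus_of_varianceBound`).  Output (array `Karr c` of `StarLemmaGArray`):

* `star_isLinkWindowContraction` — hypothesis (H1) of the star door for the star windows, array `Karr c`;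
* `sum_Karr_eq_gaugeR_coef` — (H2): every star link receives exactly `R_G(4c) = 6c(1+c)/(1 − 4c − 6c²)`;
* `star_window_of_isKRContraction` — the four clauses (nonnegativity, support, (H1), (H2)) bundled, ready
  for the torus door `DSWindow.star_abs_covariance_le` and the `ℤ^4` uniqueness door
  `DSWindowZd.hasUniqueGibbsMeasure_of_isLinkWindowContraction` (rows: `StarSUNRows.lean`).

References: ds-4 `StarWindowBoundLemmaG.lean` (the `SU(2)` file this one follows line by line), cell files
`GAUGE-STAR.md` (ds-2), `B4-BLUEPRINT.md`, `STAR-PROOF.md` P10/P12 (ds-4); H. Föllmer, LNM 1362 (1988)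
Ch. I; R. L. Dobrushin, S. B. Shlosman (1985).
-/

noncomputable section

open MeasureTheory Function Finset
open Literature.Probability.LatticeModels
open Literature.Probability.LatticeModels.DobrushinMetric
open Literature.MathematicalPhysics.QuantumFieldTheory
open Literature.MathematicalPhysics.QuantumFieldTheory.Balaban1983to89.StrongCouplingTorusWindow
open Summit.Ventures.YMGap.DSWindow
open Summit.Ventures.YMGap.StarKernel
open Summit.Ventures.YMGap.StarColumn
open Summit.Ventures.YMGap.StarWindowGauge (gaugeR)
open Summit.Ventures.YMGap.StarLemmaG

namespace Summit.Ventures.YMGap.StarLemmaGSUN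

variable {L : ℕ} [NeZero L] {N : ℕ}

/-! ### Wilson-weight facts (`SU(N)`) -/

omit [NeZero L] in
/-- The `SU(N)` Wilson plaquette weight is a class function. [folklore] -/
theorem wilsonPlaqWeight_conj (β : ℝ) (g h : Matrix.specialUnitaryGroup (Fin N) ℂ) :
    wilsonPlaqWeight N β (g * h * g⁻¹) = wilsonPlaqWeight N β h := by
  have htr : ((g * h * g⁻¹ : Matrix.specialUnitaryGroup (Fin N) ℂ) : Matrix (Fin N) (Fin N) ℂ).trace =
      ((h : Matrix.specialUnitaryGroup (Fin N) ℂ) : Matrix (Fin N) (Fin N) ℂ).trace := by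
    rw [Submonoid.coe_mul, Matrix.trace_mul_comm, ← Submonoid.coe_mul, inv_mul_cancel_left]
  simp only [wilsonPlaqWeight, htr]

omit [NeZero L] in
/-- The Frobenius distance on `SU(N)` is invariant under two-sided translations. [folklore] -/
theorem suFrobDist_mul_mul (a b x y : Matrix.specialUnitaryGroup (Fin N) ℂ) :
    suFrobDist (a * x * b) (a * y * b) = suFrobDist x y := by
  unfold suFrobDist
  have h : ((a * x * b : Matrix.specialUnitaryGroup (Fin N) ℂ) : Matrix (Fin N) (Fin N) ℂ) -
        ((a * y * b : Matrix.specialUnitaryGroup (Fin N) ℂ) : Matrix (Fin N) (Fin N) ℂ)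
      = (a : Matrix (Fin N) (Fin N) ℂ) *
        ((((x : Matrix.specialUnitaryGroup (Fin N) ℂ) : Matrix (Fin N) (Fin N) ℂ) -
          ((y : Matrix.specialUnitaryGroup (Fin N) ℂ) : Matrix (Fin N) (Fin N) ℂ)) *
          (b : Matrix (Fin N) (Fin N) ℂ)) := by
    simp only [Submonoid.coe_mul]
    rw [Matrix.sub_mul, Matrix.mul_sub, Matrix.mul_assoc, Matrix.mul_assoc]
  rw [h, frobNorm_unitary_mul (su_mem_unitaryGroup a), frobNorm_mul_unitary _ (su_mem_unitaryGroup b)]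

/-! ### The one-sided comparison (gauge fixed at `a`) -/

/-- **One-sided bound, generic coefficient.**  Star plaquette `q` of `s` with star links `a ≠ b`,
boundary link `y ∈ q` off the star, `ω = η` off `y`, `f` a bounded measurable observable of the star
links with per-link Lipschitz vector `δ` for `suFrobDist`; the `SU(N)` torus Wilson specification at tree
coupling `β` is assumed to have single-link Dobrushin coefficients `c · tInfluence` with `0 ≤ c < 1/6`.
Then `|∫ f dγ_⋆(ω) − ∫ f dγ_⋆(η)| ≤ suFrobDist(ω_y, η_y) · Σ_{x ∈ ⋆} (c · kside c s a b x) δ_x`: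
gauge-average `f` at `s`, freeze `a`, compare the two frozen kernels on `⋆ ∖ {a}` by Föllmer's
comparison with the super-solution `dvec` (`DobrushinMetric.abs_kernel_sub_le_of_superSolution`).
Port of `StarLemmaG.oneSided` (`SU(2)`, `c = β_W/4`). [folklore] -/
theorem oneSided (hL : 3 ≤ L) {β c : ℝ} (hc0 : 0 ≤ c) (hc6 : c < 1 / 6)
    (hK : IsKRContraction (torusWeightSpec (d := 4) (L := L) (wilsonPlaqWeight N β)) suFrobDist
      linkNbrT fun e z => c * (tInfluence e z : ℝ))
    {s : Site 4 L}
    {q : Plaquette 4 L} (hq : q ∈ starPlaqs s) {y : Edge 4 L} (hyq : y ∈ plaqEdgesT q)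
    (hy : y ∉ vertexStar s) {a b : Edge 4 L} (ha : a ∈ vertexStar s) (haq : a ∈ plaqEdgesT q)
    (hb : b ∈ vertexStar s) (hbq : b ∈ plaqEdgesT q) (hab : a ≠ b)
    {ω η : GaugeConfig 4 L (Matrix.specialUnitaryGroup (Fin N) ℂ)} (hωη : ∀ e, e ≠ y → ω e = η e)
    {f : GaugeConfig 4 L (Matrix.specialUnitaryGroup (Fin N) ℂ) → ℝ} (hfm : Measurable f) {B : ℝ}
    (hB : ∀ U, |f U| ≤ B)
    (hfdep : DependsOn f (↑(vertexStar s) : Set (Edge 4 L))) {δ : Edge 4 L → ℝ} (hδ0 : ∀ x, 0 ≤ δ x)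
    (hlip : ∀ (x : Edge 4 L) (σ τ : GaugeConfig 4 L (Matrix.specialUnitaryGroup (Fin N) ℂ)),
      (∀ e, e ≠ x → σ e = τ e) →
      |f σ - f τ| ≤ δ x * suFrobDist (σ x) (τ x)) :
    |∫ U, f U ∂(torusWeightSpec (wilsonPlaqWeight N β) (vertexStar s) ω) -
        ∫ U, f U ∂(torusWeightSpec (wilsonPlaqWeight N β) (vertexStar s) η)| ≤
      suFrobDist (ω y) (η y) * ∑ x ∈ vertexStar s, (c * kside c s a b x) * δ x := by
  haveI : SecondCountableTopology (Matrix (Fin N) (Fin N) ℂ) :=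
    inferInstanceAs (SecondCountableTopology (Fin N → Fin N → ℂ))
  haveI : SecondCountableTopology (Matrix.specialUnitaryGroup (Fin N) ℂ) :=
    Topology.IsEmbedding.subtypeVal.secondCountableTopology
  set v : Matrix.specialUnitaryGroup (Fin N) ℂ → ℝ := wilsonPlaqWeight N β with hvdef
  have hvc : Continuous v := continuous_wilsonPlaqWeight (N := N) β
  have hv0 : ∀ g, 0 < v g := wilsonPlaqWeight_pos (N := N) β
  have hvconj : ∀ g h : Matrix.specialUnitaryGroup (Fin N) ℂ, v (g * h * g⁻¹) = v h :=
    wilsonPlaqWeight_conj β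
  have hL1 : 1 < L := by omega
  have hΛ : ∀ e : Edge 4 L, (e.1 = s ∨ e.1.shift e.2 = s) → e ∈ vertexStar s :=
    fun e he => mem_vertexStar_iff'.2 he
  have ha' : a.1 = s ∨ a.1.shift a.2 = s := mem_vertexStar_iff'.1 ha
  have hya : y ≠ a := fun h => hy (h ▸ ha)
  have hc1 : c ≤ 7 / 40 := by linarith
  -- Step 1: gauge average at `s`
  set fb := StarGauge.gaugeAvg s f with hfb
  have hfbm : Measurable fb := StarGauge.measurable_gaugeAvg s hfm
  have hfbB : ∀ U, |fb U| ≤ B := StarGauge.abs_gaugeAvg_le s hB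
  have hfbdep : DependsOn fb (↑(vertexStar s) : Set (Edge 4 L)) := StarGauge.dependsOn_gaugeAvg s hfdep
  have hfbinv : ∀ (g : Matrix.specialUnitaryGroup (Fin N) ℂ)
      (U : GaugeConfig 4 L (Matrix.specialUnitaryGroup (Fin N) ℂ)),
      fb (gaugeTransform (StarGauge.gaugeAt s g) U) = fb U :=
    StarGauge.gaugeAvg_gaugeTransform_gaugeAt s f
  have hfblip : ∀ (x : Edge 4 L) (σ τ : GaugeConfig 4 L (Matrix.specialUnitaryGroup (Fin N) ℂ)),
      (∀ e, e ≠ x → σ e = τ e) →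
      |fb σ - fb τ| ≤ δ x * suFrobDist (σ x) (τ x) :=
    StarGauge.lip_gaugeAvg s suFrobDist_mul_mul hfm hB hlip
  rw [StarGauge.integral_sub_integral_eq_gaugeAvg hvc hv0 hvconj hΛ ω η hfm hB]
  -- Step 2: freeze the link `a`
  rw [StarGauge.integral_torusWeightSpec_eq_erase hvc hv0 hvconj hL1 hΛ ha' ω hfbm hfbB hfbinv,
    StarGauge.integral_torusWeightSpec_eq_erase hvc hv0 hvconj hL1 hΛ ha' η hfbm hfbB hfbinv]
  -- Step 3: under the frozen kernels, `fb = F := fb ∘ (update · a 1)` almost surely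
  set Λ' := (vertexStar s).erase a with hΛ'
  set F : GaugeConfig 4 L (Matrix.specialUnitaryGroup (Fin N) ℂ) → ℝ := fun U => fb (update U a 1) with hF
  have hγ := isSpecification_torusWeightSpec (d := 4) (L := L) hvc hv0
  have step3 : ∀ ζ : GaugeConfig 4 L (Matrix.specialUnitaryGroup (Fin N) ℂ),
      ∫ U, fb U ∂(torusWeightSpec v Λ' (update ζ a 1)) =
        ∫ U, F U ∂(torusWeightSpec v Λ' (update ζ a 1)) := by
    intro ζ
    refine integral_congr_ae ?_
    filter_upwards [hγ.proper Λ' (update ζ a 1)] with U hU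
    have hUa : U a = 1 := by rw [hU a (notMem_erase a _), update_self]
    show fb U = fb (update U a 1)
    rw [← hUa, update_eq_self]
  rw [step3 ω, step3 η]
  -- Step 4: Föllmer's comparison on `Λ'` with the super-solution `dvec`
  have hyΛ' : y ∉ Λ' := fun h => hy (mem_of_mem_erase h)
  have hω'η' : ∀ z, z ≠ y → update ω a 1 z = update η a 1 z := by
    intro z hz
    by_cases hza : z = a
    · subst hza; simp
    · rw [update_of_ne hza, update_of_ne hza, hωη z hz]
  -- the test function `F`: measurable, bounded, depends on `Λ'`, Lipschitz vector `δ' = δ` off `a`, `0` at `a`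
  have hFm : Measurable F :=
    hfbm.comp (measurable_update' (a := a) |>.comp (measurable_id.prodMk measurable_const))
  have hFB : ∀ U, |F U| ≤ B := fun U => hfbB _
  have hFdep : DependsOn F (↑Λ' : Set (Edge 4 L)) := by
    intro U U' hUU'
    show fb (update U a 1) = fb (update U' a 1)
    refine hfbdep fun e he => ?_
    by_cases hea : e = a
    · subst hea; simp
    · rw [update_of_ne hea, update_of_ne hea]
      exact hUU' e (Finset.mem_coe.2 (mem_erase.2 ⟨hea, Finset.mem_coe.1 he⟩))
  set δ' : Edge 4 L → ℝ := fun z => if z = a then 0 else δ z with hδ'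
  have hFlip : IsLipBound suFrobDist F δ' := by
    refine ⟨fun z => by simp only [hδ']; split_ifs; exacts [le_rfl, hδ0 z], fun z σ τ hστ => ?_⟩
    show |fb (update σ a 1) - fb (update τ a 1)| ≤ δ' z * suFrobDist (σ z) (τ z)
    by_cases hza : z = a
    · subst hza
      have hst : update σ z 1 = update τ z 1 := by
        funext e
        by_cases hez : e = z
        · subst hez; simp
        · rw [update_of_ne hez, update_of_ne hez, hστ e hez]
      rw [hst, sub_self, abs_zero]
      simp [hδ']
    · have h := hfblip z (update σ a 1) (update τ a 1) (fun e hez => by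
        by_cases hea : e = a
        · subst hea; simp
        · rw [update_of_ne hea, update_of_ne hea, hστ e hez])
      rw [update_of_ne hza, update_of_ne hza] at h
      simpa only [hδ', if_neg hza] using h
  have key := abs_kernel_sub_le_of_superSolution hγ hK (fun p q => suFrobDist_nonneg p q)
    (fun p q => suFrobDist_le p q) (R := 2 * Real.sqrt N) (by positivity) Λ' hyΛ' hω'η'
    (d := dvec c s y a b) (dvec_nonneg hc0 hc1 s y a b) (by simp [dvec])
    (fun x hx => dvec_superSolution hL hc0 hc1 hq hyq hy ha haq hb hbq hab hx)
    (c := 6 * c) (by linarith) (by linarith)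
    (fun x hx => rowSum_frozenStar_le hL hc0 ha hx)
    hFm hFdep hFB hFlip
  -- rewrite the bound: `ω' y = ω y`, the sum over `Λ'` of `dvec · δ'` is the sum over `⋆` of `c · kside · δ`
  rw [update_of_ne hya, update_of_ne hya] at key
  refine key.trans (le_of_eq ?_)
  congr 1
  have hterm : ∀ z ∈ vertexStar s, dvec c s y a b z * δ' z = c * kside c s a b z * δ z := by
    intro z hz
    have hzy : z ≠ y := fun h => hy (h ▸ hz)
    by_cases hza : z = a
    · subst hza; simp [dvec, kside, hδ', hzy]
    · simp only [dvec, if_neg hzy, if_pos hz, hδ', if_neg hza]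
  rw [← sum_congr rfl hterm, hΛ']
  have haterm : dvec c s y a b a * δ' a = 0 := by simp [hδ']
  rw [sum_erase (vertexStar s) haterm]

/-! ### (H1), (H2) and the bundled window clauses -/

/-- **(H1) for the `SU(N)` star windows with the Lemma-G array `Karr c`**, from single-link Dobrushin
coefficients `c · tInfluence` of the torus Wilson specification (`0 ≤ c < 1/6`, torus side `L ≥ 3`):
the two one-sided comparisons (`oneSided`, averaged) on the star boundary, quasilocality
(`StarKernel.specAvg_vertexStar_eq_of_not_mem`) off it.  Port of the (H1) clause of
`StarLemmaG.starWindowBound_lemmaG`. [folklore] -/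
theorem star_isLinkWindowContraction (hL : 3 ≤ L) {β c : ℝ} (hc0 : 0 ≤ c) (hc6 : c < 1 / 6)
    (hK : IsKRContraction (torusWeightSpec (d := 4) (L := L) (wilsonPlaqWeight N β)) suFrobDist
      linkNbrT fun e z => c * (tInfluence e z : ℝ)) :
    IsLinkWindowContraction (d := 4) (L := L) (wilsonPlaqWeight N β) suFrobDist starWin
      fun e => Karr c e.1 := by
  have hL1 : 1 < L := by omega
  have hc1 : c ≤ 7 / 40 := by linarith
  intro e y hy ω η hωη f δ hfm hfB hfdep hδ0 hlip
  obtain ⟨B, hB⟩ := hfB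
  set s := e.1
  change y ∉ vertexStar s at hy
  change DependsOn f (↑(vertexStar s) : Set (Edge 4 L)) at hfdep
  show |∫ U, f U ∂(torusWeightSpec (wilsonPlaqWeight N β) (vertexStar s) ω) -
      ∫ U, f U ∂(torusWeightSpec (wilsonPlaqWeight N β) (vertexStar s) η)| ≤
    (∑ x ∈ vertexStar s, Karr c s y x * δ x) * suFrobDist (ω y) (η y)
  by_cases hyb : y ∈ starBoundary s
  · obtain ⟨⟨q, hq, hyq⟩, -⟩ := mem_starBoundary.1 hyb
    obtain ⟨a, b, hab, hf2⟩ := filter_mem_vertexStar_plaqEdgesT hL1 hq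
    have ha2 : a ∈ (plaqEdgesT q).filter (fun e => e ∈ vertexStar s) := by rw [hf2]; simp
    have hb2 : b ∈ (plaqEdgesT q).filter (fun e => e ∈ vertexStar s) := by rw [hf2]; simp
    obtain ⟨haq, ha⟩ := mem_filter.1 ha2
    obtain ⟨hbq, hb⟩ := mem_filter.1 hb2
    have hA := oneSided hL hc0 hc6 hK hq hyq hy ha haq hb hbq hab hωη hfm hB hfdep hδ0 hlip
    have hB' := oneSided hL hc0 hc6 hK hq hyq hy hb hbq ha haq hab.symm hωη hfm hB hfdep hδ0 hlip
    -- average the two one-sided bounds and compare with the array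
    have hr0 : 0 ≤ suFrobDist (ω y) (η y) := suFrobDist_nonneg _ _
    have hpair : ∀ x ∈ vertexStar s,
        (c * kside c s a b x + c * kside c s b a x) / 2 ≤ Karr c s y x := by
      intro x hx
      have hKx : Karr c s y x = (c / 2) *
          ∑ q' ∈ (starPlaqs s).filter (fun q' => y ∈ plaqEdgesT q'),
            ∑ ab ∈ starPairsOf s q', kside c s ab.1 ab.2 x := by
        simp only [Karr, if_pos (And.intro hx hy)]
      rw [hKx]
      have hqmem : q ∈ (starPlaqs s).filter (fun q' => y ∈ plaqEdgesT q') := mem_filter.2 ⟨hq, hyq⟩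
      have hsub : ({(a, b), (b, a)} : Finset (Edge 4 L × Edge 4 L)) ⊆ starPairsOf s q := by
        intro p hp
        simp only [mem_insert, mem_singleton] at hp
        rcases hp with rfl | rfl
        · exact mem_starPairsOf.2 ⟨⟨haq, ha⟩, ⟨hbq, hb⟩, hab⟩
        · exact mem_starPairsOf.2 ⟨⟨hbq, hb⟩, ⟨haq, ha⟩, hab.symm⟩
      have hinner : kside c s a b x + kside c s b a x ≤
          ∑ ab ∈ starPairsOf s q, kside c s ab.1 ab.2 x := by
        have hne : (a, b) ≠ (b, a) := fun h => hab (Prod.mk.inj h).1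
        calc kside c s a b x + kside c s b a x
            = ∑ ab ∈ ({(a, b), (b, a)} : Finset (Edge 4 L × Edge 4 L)), kside c s ab.1 ab.2 x := by
              rw [sum_pair hne]
          _ ≤ _ := sum_le_sum_of_subset_of_nonneg hsub fun ab _ _ => kside_nonneg hc0 hc1 s _ _ _
      have houter : ∑ ab ∈ starPairsOf s q, kside c s ab.1 ab.2 x ≤
          ∑ q' ∈ (starPlaqs s).filter (fun q' => y ∈ plaqEdgesT q'),
            ∑ ab ∈ starPairsOf s q', kside c s ab.1 ab.2 x := by
        have h := single_le_sum (f := fun q' => ∑ ab ∈ starPairsOf s q', kside c s ab.1 ab.2 x)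
          (fun q' _ => sum_nonneg fun ab _ => kside_nonneg hc0 hc1 s _ _ _) hqmem
        exact h
      nlinarith
    have hsum : (∑ x ∈ vertexStar s, (c * kside c s a b x) * δ x +
        ∑ x ∈ vertexStar s, (c * kside c s b a x) * δ x) / 2 ≤
          ∑ x ∈ vertexStar s, Karr c s y x * δ x := by
      rw [← sum_add_distrib, Finset.sum_div]
      refine sum_le_sum fun x hx => ?_
      have h := mul_le_mul_of_nonneg_right (hpair x hx) (hδ0 x)
      refine le_trans (le_of_eq ?_) h
      ring
    calc |∫ U, f U ∂(torusWeightSpec (wilsonPlaqWeight N β) (vertexStar s) ω) -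
          ∫ U, f U ∂(torusWeightSpec (wilsonPlaqWeight N β) (vertexStar s) η)|
        = (|∫ U, f U ∂(torusWeightSpec (wilsonPlaqWeight N β) (vertexStar s) ω) -
            ∫ U, f U ∂(torusWeightSpec (wilsonPlaqWeight N β) (vertexStar s) η)| +
          |∫ U, f U ∂(torusWeightSpec (wilsonPlaqWeight N β) (vertexStar s) ω) -
            ∫ U, f U ∂(torusWeightSpec (wilsonPlaqWeight N β) (vertexStar s) η)|) / 2 := by
          ring
      _ ≤ (suFrobDist (ω y) (η y) * ∑ x ∈ vertexStar s, (c * kside c s a b x) * δ x +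
            suFrobDist (ω y) (η y) * ∑ x ∈ vertexStar s, (c * kside c s b a x) * δ x) / 2 := by
          gcongr
      _ = suFrobDist (ω y) (η y) * ((∑ x ∈ vertexStar s, (c * kside c s a b x) * δ x +
            ∑ x ∈ vertexStar s, (c * kside c s b a x) * δ x) / 2) := by ring
      _ ≤ suFrobDist (ω y) (η y) * ∑ x ∈ vertexStar s, Karr c s y x * δ x :=
          mul_le_mul_of_nonneg_left hsum hr0
      _ = (∑ x ∈ vertexStar s, Karr c s y x * δ x) * suFrobDist (ω y) (η y) := mul_comm _ _
  · -- `y` off the star boundary: the kernel does not see `ω y`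
    haveI : SecondCountableTopology (Matrix (Fin N) (Fin N) ℂ) :=
      inferInstanceAs (SecondCountableTopology (Fin N → Fin N → ℂ))
    haveI : SecondCountableTopology (Matrix.specialUnitaryGroup (Fin N) ℂ) :=
      Topology.IsEmbedding.subtypeVal.secondCountableTopology
    rw [specAvg_vertexStar_eq_of_not_mem (continuous_wilsonPlaqWeight (N := N) β) s hfm hfdep
      hyb hωη, sub_self, abs_zero]
    exact mul_nonneg (sum_nonneg fun x _ => mul_nonneg (Karr_nonneg hc0 hc1 s y x) (hδ0 x))
      (suFrobDist_nonneg _ _)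

omit [NeZero L] in
/-- **(H2) in the coefficient**: for `0 ≤ c ≤ 7/40` and torus side `≥ 3`, every star link `x` of `s`
receives exactly `Σ_y Karr c (s; y → x) = R_G(4c)` (`StarWindowGauge.gaugeR`, i.e.
`6c(1+c)/(1 − 4c − 6c²)`) — `StarLemmaG.sum_Karr_eq_gaugeR` read at `β = 4c`. [folklore] -/
theorem sum_Karr_eq_gaugeR_coef [NeZero L] (hL : 3 ≤ L) {c : ℝ} (hc0 : 0 ≤ c) (hc1 : c ≤ 7 / 40)
    {s : Site 4 L} {x : Edge 4 L} (hx : x ∈ vertexStar s) :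
    ∑ y : Edge 4 L, Karr c s y x = gaugeR (4 * c) := by
  have h := sum_Karr_eq_gaugeR hL (β := 4 * c) (by linarith) (by linarith) hx
  have e : 4 * c / 4 = c := by ring
  rw [e] at h
  exact h

/-- **The `SU(N)` star window, all four clauses, from single-link Dobrushin coefficients `c · tInfluence`
(`0 ≤ c < 1/6`, torus side `L ≥ 3`)**: the array `Karr c` is nonnegative, supported on boundary links
within periodic sup-distance `1` of the centre, satisfies the window contraction (H1) for the star windows
of the `SU(N)` torus Wilson specification at tree coupling `β`, and has per-star received sum EXACTLY
`R_G(4c)` — the input format of the torus door `DSWindow.star_abs_covariance_le` and of the `ℤ^4` door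
`DSWindowZd.hasUniqueGibbsMeasure_of_isLinkWindowContraction` (both need `R_G(4c) < 1`, i.e. `4c ≤ 9/25`
with the tree's `gaugeR_lt_one_of_le`).  Generic-`N` form of `StarLemmaG.starWindowBound_lemmaG`.
[folklore] -/
theorem star_window_of_isKRContraction (hL : 3 ≤ L) {β c : ℝ} (hc0 : 0 ≤ c) (hc6 : c < 1 / 6)
    (hK : IsKRContraction (torusWeightSpec (d := 4) (L := L) (wilsonPlaqWeight N β)) suFrobDist
      linkNbrT fun e z => c * (tInfluence e z : ℝ)) :
    (∀ s y x, 0 ≤ Karr (L := L) c s y x) ∧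
      (∀ (s : Site 4 L) y x, Karr c s y x ≠ 0 → ∀ w ∈ linkEnds y, torusNorm (s - w) ≤ 1) ∧
      IsLinkWindowContraction (d := 4) (L := L) (wilsonPlaqWeight N β) suFrobDist starWin
        (fun e => Karr c e.1) ∧
      ∀ (s : Site 4 L) (x : Edge 4 L), x ∈ vertexStar s → ∑ y, Karr c s y x = gaugeR (4 * c) := by
  have hc1 : c ≤ 7 / 40 := by linarith
  exact ⟨fun s y x => Karr_nonneg hc0 hc1 s y x, fun s y x h => Karr_loc s y x h,
    star_isLinkWindowContraction hL hc0 hc6 hK, fun s x hx => sum_Karr_eq_gaugeR_coef hL hc0 hc1 hx⟩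

/-- **The same, fed by a one-link modulus** (`isKRContraction_torusWilson`): an `SU(N)` one-link
Kantorovich–Rubinstein modulus `OneLinkKRModulus N R K` on the tilt ball `R ≥ 6|β|/N` (`d = 4`: six
plaquettes per link), `K ≥ 0`, with per-incidence coefficient `c = K·|β|/N < 1/6`, gives the four window
clauses with the array `Karr (K·|β|/N)` and received sum `R_G(4K|β|/N)`. [folklore] -/
theorem star_window_of_oneLinkKRModulus (hL : 3 ≤ L) (hN : 1 ≤ N) {β R K : ℝ} (hK0 : 0 ≤ K)
    (hR : |β| / N * 6 ≤ R) (hmod : Balaban1983to89.StrongCouplingDobrushinWindow.OneLinkKRModulus N R K)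
    (hc6 : K * (|β| / N) < 1 / 6) :
    (∀ s y x, 0 ≤ Karr (L := L) (K * (|β| / N)) s y x) ∧
      (∀ (s : Site 4 L) y x, Karr (K * (|β| / N)) s y x ≠ 0 → ∀ w ∈ linkEnds y, torusNorm (s - w) ≤ 1) ∧
      IsLinkWindowContraction (d := 4) (L := L) (wilsonPlaqWeight N β) suFrobDist starWin
        (fun e => Karr (K * (|β| / N)) e.1) ∧
      ∀ (s : Site 4 L) (x : Edge 4 L), x ∈ vertexStar s →
        ∑ y, Karr (K * (|β| / N)) s y x = gaugeR (4 * (K * (|β| / N))) := by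
  have hL1 : 1 < L := by omega
  have hKR := isKRContraction_torusWilson (d := 4) (N := N) (L := L) (by norm_num) hN hL1 hK0
    (by push_cast; linarith) hmod
  exact star_window_of_isKRContraction hL (mul_nonneg hK0 (by positivity)) hc6 hKR

end Summit.Ventures.YMGap.StarLemmaGSUN

end
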